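import Summits.RiemannHypothesis.RiemannHypothesis.Theorems.HardyZLehmerSplitSigmaLLaguerreCone
import Summits.RiemannHypothesis.RiemannHypothesis.Theorems.SigmaLOnLineW0
import HarnessLib

/-!
# Crux `SigmaL` (stmt-RiemannHypothesis-24253) — Σ_L and the Laguerre inequality at critical points,
# UNCONDITIONALLY on the widened window `W0' = (H₀ + 20, H₀ + 39)`, `H₀ = 3 000 175 332 800`

The certified computation `SigmaLCert.stub_onLine_W0` (`Theorems/SigmaLOnLineW0.lean`, `native_decide`:
every zero of `ζ` with ordinate in `(H₀ + 19, H₀ + 40)` is on the critical line — Riemann–Siegel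
interval arithmetic + Turing's method) fed to the UNIT-PADDING window theorems of the cone file
(`laguerreAtCritical_of_onLine'`, `noViolationOn_of_onLine'`,
`Theorems/HardyZLehmerSplitSigmaLLaguerreCone.lean`): the same certificate now covers `(H₀ + 20, H₀ + 39)`
instead of `(H₀ + 20, H₀ + 30)` (`laguerreAtCritical_W0`, BC5 rung `SigmaLRung.SigmaL_rung_W0`, which used
the `+8` padding). Decidable data above the Platt–Trudgian height; NOTHING HERE PROVES OR ASSUMES RH;
`SigmaL` itself (all `t > 3·10¹²`) stays OPEN.
-/

set_option linter.dupNamespace false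
set_option autoImplicit false

noncomputable section

open Literature.NumberTheory.LFunctions
open Summit.RiemannHypothesis.RiemannHypothesis.Theorems.SigmaLRung

namespace Summit.RiemannHypothesis.RiemannHypothesis.Theorems.SigmaLBirth

/-- **Unconditional instance on `W0' = (H₀ + 20, H₀ + 39)`, `H₀ = 3 000 175 332 800`** (unit padding;
was `(H₀ + 20, H₀ + 30)`, `laguerreAtCritical_W0`): at every critical point of `Z` there with `Z ≠ 0`,
`Z·Z'' < 0` — from the certified computation `SigmaLCert.stub_onLine_W0` (all zeros of `ζ` with
ordinate in `(H₀ + 19, H₀ + 40)` are on the line) by `laguerreAtCritical_of_onLine'`. Decidable data,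
RH-free; nothing here bears on the truth of RH. -/
theorem laguerreAtCritical_W0' :
    ∀ t : ℝ, 3000175332820 < t → t < 3000175332839 → deriv hardyZ t = 0 → hardyZ t ≠ 0 →
      hardyZ t * deriv (deriv hardyZ) t < 0 :=
  laguerreAtCritical_of_onLine' (A' := 3000175332819) (B' := 3000175332840)
    (by norm_num) (by norm_num) (by norm_num) SigmaLCert.stub_onLine_W0

/-- **Σ_L UNCONDITIONALLY on `W0' = (H₀ + 20, H₀ + 39)`** (unit padding widens the BC5 rung
`SigmaLRung.SigmaL_rung_W0`, which covered `(H₀ + 20, H₀ + 30)`): Hardy's `Z` has no positive local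
minimum and no negative local maximum there — from the certified computation
`SigmaLCert.stub_onLine_W0` by `noViolationOn_of_onLine'`. Decidable data above the Platt–Trudgian
height, RH-free; nothing here bears on the truth of RH; `SigmaL` itself (all `t > 3·10¹²`) stays open. -/
theorem noViolation_W0' :
    ∀ t : ℝ, 3000175332820 < t → t < 3000175332839 →
      (IsLocalMin hardyZ t → hardyZ t ≤ 0) ∧ (IsLocalMax hardyZ t → 0 ≤ hardyZ t) :=
  noViolationOn_of_onLine' (A' := 3000175332819) (B' := 3000175332840)
    (by norm_num) (by norm_num) (by norm_num) SigmaLCert.stub_onLine_W0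

end Summit.RiemannHypothesis.RiemannHypothesis.Theorems.SigmaLBirth

end
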